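import Literature.NumberTheory.LFunctions.WeilFirstPrimeCertificateANu1
import HarnessLib

/-!
# First-prime Weil positivity on `C(2/5)`: kernel check of the moments, part `2/2`

Sibling of `WeilFirstPrimeCertificateDataA.lean`: the claimed moments `ν_q` (`weilCert2ANu`) agree
with `WeilCert2.nuQ` (`= a₀^q · 2 Σ_cells ∫ (wL − σ) s^q`, exact rational integration of the cell
polynomials) at the even `q = 60 … 98` — one kernel evaluation per moment (`checkNuAt`), since a
single evaluation of the whole table exhausts the kernel's memory (and so does parallel elaboration, whence
`Elab.async false`). The parts are assembled into `checkNu` at the end of this file.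
-/

set_option Elab.async false

noncomputable section

namespace Literature.NumberTheory.LFunctions

/-- Moment `ν_{60}`. [folklore] -/
theorem weilCert2A_nu_30 : weilCert2A.checkNuAt 60 = true := by
  decide +kernel

/-- Moment `ν_{62}`. [folklore] -/
theorem weilCert2A_nu_31 : weilCert2A.checkNuAt 62 = true := by
  decide +kernel

/-- Moment `ν_{64}`. [folklore] -/
theorem weilCert2A_nu_32 : weilCert2A.checkNuAt 64 = true := by
  decide +kernel

/-- Moment `ν_{66}`. [folklore] -/
theorem weilCert2A_nu_33 : weilCert2A.checkNuAt 66 = true := by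
  decide +kernel

/-- Moment `ν_{68}`. [folklore] -/
theorem weilCert2A_nu_34 : weilCert2A.checkNuAt 68 = true := by
  decide +kernel

/-- Moment `ν_{70}`. [folklore] -/
theorem weilCert2A_nu_35 : weilCert2A.checkNuAt 70 = true := by
  decide +kernel

/-- Moment `ν_{72}`. [folklore] -/
theorem weilCert2A_nu_36 : weilCert2A.checkNuAt 72 = true := by
  decide +kernel

/-- Moment `ν_{74}`. [folklore] -/
theorem weilCert2A_nu_37 : weilCert2A.checkNuAt 74 = true := by
  decide +kernel

/-- Moment `ν_{76}`. [folklore] -/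
theorem weilCert2A_nu_38 : weilCert2A.checkNuAt 76 = true := by
  decide +kernel

/-- Moment `ν_{78}`. [folklore] -/
theorem weilCert2A_nu_39 : weilCert2A.checkNuAt 78 = true := by
  decide +kernel

/-- Moment `ν_{80}`. [folklore] -/
theorem weilCert2A_nu_40 : weilCert2A.checkNuAt 80 = true := by
  decide +kernel

/-- Moment `ν_{82}`. [folklore] -/
theorem weilCert2A_nu_41 : weilCert2A.checkNuAt 82 = true := by
  decide +kernel

/-- Moment `ν_{84}`. [folklore] -/
theorem weilCert2A_nu_42 : weilCert2A.checkNuAt 84 = true := by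
  decide +kernel

/-- Moment `ν_{86}`. [folklore] -/
theorem weilCert2A_nu_43 : weilCert2A.checkNuAt 86 = true := by
  decide +kernel

/-- Moment `ν_{88}`. [folklore] -/
theorem weilCert2A_nu_44 : weilCert2A.checkNuAt 88 = true := by
  decide +kernel

/-- Moment `ν_{90}`. [folklore] -/
theorem weilCert2A_nu_45 : weilCert2A.checkNuAt 90 = true := by
  decide +kernel

/-- Moment `ν_{92}`. [folklore] -/
theorem weilCert2A_nu_46 : weilCert2A.checkNuAt 92 = true := by
  decide +kernel

/-- Moment `ν_{94}`. [folklore] -/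
theorem weilCert2A_nu_47 : weilCert2A.checkNuAt 94 = true := by
  decide +kernel

/-- Moment `ν_{96}`. [folklore] -/
theorem weilCert2A_nu_48 : weilCert2A.checkNuAt 96 = true := by
  decide +kernel

/-- Moment `ν_{98}`. [folklore] -/
theorem weilCert2A_nu_49 : weilCert2A.checkNuAt 98 = true := by
  decide +kernel

/-- **Kernel check of the table of moments** (`ν_q = a₀^q ∫ γ t^q` at the even `q ≤ 2N`). [folklore] -/
theorem checkNu_weilCert2A : weilCert2A.checkNu = true := by
  refine WeilCert2.allBelow_of_forall fun j hj ↦ ?_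
  have hN : weilCert2A.base.N + 1 = 50 := rfl
  rw [hN] at hj
  interval_cases j
  · exact weilCert2A_nu_0
  · exact weilCert2A_nu_1
  · exact weilCert2A_nu_2
  · exact weilCert2A_nu_3
  · exact weilCert2A_nu_4
  · exact weilCert2A_nu_5
  · exact weilCert2A_nu_6
  · exact weilCert2A_nu_7
  · exact weilCert2A_nu_8
  · exact weilCert2A_nu_9
  · exact weilCert2A_nu_10
  · exact weilCert2A_nu_11
  · exact weilCert2A_nu_12
  · exact weilCert2A_nu_13
  · exact weilCert2A_nu_14
  · exact weilCert2A_nu_15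
  · exact weilCert2A_nu_16
  · exact weilCert2A_nu_17
  · exact weilCert2A_nu_18
  · exact weilCert2A_nu_19
  · exact weilCert2A_nu_20
  · exact weilCert2A_nu_21
  · exact weilCert2A_nu_22
  · exact weilCert2A_nu_23
  · exact weilCert2A_nu_24
  · exact weilCert2A_nu_25
  · exact weilCert2A_nu_26
  · exact weilCert2A_nu_27
  · exact weilCert2A_nu_28
  · exact weilCert2A_nu_29
  · exact weilCert2A_nu_30
  · exact weilCert2A_nu_31
  · exact weilCert2A_nu_32
  · exact weilCert2A_nu_33
  · exact weilCert2A_nu_34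
  · exact weilCert2A_nu_35
  · exact weilCert2A_nu_36
  · exact weilCert2A_nu_37
  · exact weilCert2A_nu_38
  · exact weilCert2A_nu_39
  · exact weilCert2A_nu_40
  · exact weilCert2A_nu_41
  · exact weilCert2A_nu_42
  · exact weilCert2A_nu_43
  · exact weilCert2A_nu_44
  · exact weilCert2A_nu_45
  · exact weilCert2A_nu_46
  · exact weilCert2A_nu_47
  · exact weilCert2A_nu_48
  · exact weilCert2A_nu_49

end Literature.NumberTheory.LFunctions
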